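import Summits.QuantumFields.YangMills.Theorems.UnitScaleTiltHalvingP1FlatCoreJunction
import Summits.QuantumFields.YangMills.Theorems.UnitScaleTiltProp8FlatCubeSequenceAlignedLevels
import HarnessLib

/-!
# `hP1room` PROGRAMME (LEAD-H «H = hP1room» BOARD v1 (R4), RULING L-9), (A-1) STAGE 3: ★★ THE (1.36)♭ SIZE ROWS (iii) OF THE WINDOW-TRUNCATED TORUS ONE-FORM
# `A := X ∘ rep` AT THE ROUTE's LEVEL WEIGHTS, FROM PRINT's (1.36) SIZES OF `X` ON N05's WINDOW LEVEL CUBES — the `hsize` binder of ✓`mlogChartDataMult_of_suppliers`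

Route `UnitScaleTilt`, crux K1 child «MinimiserStabilityRegPr» (stmt-QuantumFields-19200), registered stub `stub_halvingStep` (`BirthV10`), text `hP1room`.
Cell `ym3-torus` (HUMAN RULING D-0037: YM₃ on T³ is ladder rung R3 — NOT d = 4, NOT a mass gap, NOT the Clay problem), width seat `ym-ust-19200-w6` gen 2
(free-hand row (R4); (A-1) owner ★w3-20520 g5's 13:35:47Z STAGE 3; the two rows are DISPLAYED as `hsize` in ✓p638875 `HalvingP1FlatCoreChartDataDoor.mlogChartDataMult_of_suppliers`
:128–137).  `--supports stmt-QuantumFields-19200 --as helper`; THEOREMS ONLY (0 `def`, 0 `sorry`); count-neutral; nothing here claims `core′`, `hP1room`, the stub, the crux or the gap.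

THE STATEMENT.  At one member∕site `(F, n < K, x₀)` with the route cube data `(ρ, S, M)`, `1 ≤ M`, `2 ≤ S`, and J1b's window letters `(a, M′, ρ′)` with
`h0 : ρ + M ≤ ρ′ + 1`, `h1 : L + S + M ≤ ρ′ + 2`, the corner `ha`, the no-wrap `hroomW`: if the `ℤ³` one-form `X` has print's (1.36) sizes ON N05's LEVEL CUBES
`□_j^{N05} = cube L a M′ ρ′ (K−n) j` —
  (hX1) `(Lʲη)·‖X z ν‖ ≤ c` for `z ∈ □_j^{N05}`,   (hX2) `(Lʲη)²·η⁻¹·‖X (z + e_{ν′}) ν − X z ν‖ ≤ c` for `z ∈ □_j^{N05}`, `z + e_{ν′} ∈ □_0^{N05}`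
(`η = L^{−(K−n)}`, `η⁻¹ = L^{K−n}`), then the torus one-form `A b := X (rep b₋) (dir b)` on the bonds with both ends in `□₀^{route} = cubeSetM x₀ (K−n) ρ S M 0` and `0`
elsewhere satisfies, for EVERY `IsLevWeight F n K (cubeSeqMT3 …) wt`:  `wt 1 b·‖A b‖ ≤ c` and `wt 2 b·L^{K−n}·‖A ⟨b₋ + e_{ν′}, dir b⟩ − A b‖ ≤ c` — the two rows (iii) of
✓`P1FlatPillarAt'` ∕ `hJ4mult` VERBATIM (the consumer takes `c := B₁·ε₀`).
MECHANISM.  The weight level `j = levOf` of `b₋` in the route tower puts `b₋ ∈ □_j^{route}` (`j ≥ 1`: ✓`B11Eq115Space.mem_levOf` + ✓`inOm_cubeSeqM_iff`), hence its window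
representative in `□_j^{N05}` (J1b ✓`P1FlatCoreCubeInclusion.mem_cube_of_cover_mem_cubeSetM`), where (hX1)∕(hX2) apply (✓`HalvingP1FlatCoreJunction.rep_shift` for the parallel
neighbour).  THE WINDOW-EDGE JUMP (exactly one of `b`, `b + e_{ν′}` has both ends in `□₀^{route}`) happens ONLY at route level `0` — a source of level `≥ 1` lies in `□₁^{route}`,
whose 2-neighbourhood is inside `□₀^{route}` (✓`HalvingP1FlatCoreTransportAssembly.transl_mem_cubeSetM_zero_of_near`, `2 ≤ S`) — where `wt 2 b·L^{K−n} = η` and the single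
surviving value costs `η·‖X‖ ≤ c` by (hX1) at level `0`.
HONEST SCOPE.  Bookkeeping of levels and windows; no analysis.  The sizes (hX1)∕(hX2) themselves are N05's ∕ the top step's output ((A-1) STAGE 2 names their supplier).

References: T. Bałaban, CMP **99** (1985) 75–102 [Balaban1985RegularSpaces] (Thm 2 p.83, (1.36)–(1.38) p.82, (1.131) p.99); CMP **102** (1985) 277–309
[Balaban1985Variational] ((144) p.300, (152) p.301, p.286); CMP **96** (1984) 223–250 [Balaban1984PropagatorsII] ((2.1)–(2.4) p.224).
-/

set_option autoImplicit false

noncomputable section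

open scoped BigOperators Matrix.Norms.L2Operator

namespace Summit.QuantumFields.YangMills.Theorems.HalvingP1FlatCoreWindowSizes

open Literature.MathematicalPhysics.QuantumFieldTheory.Balaban1983to89
open Literature.MathematicalPhysics.QuantumFieldTheory.Balaban1983to89.T3ContinuumYM3Torus
open B5Eq118OneStroke (iterBlockOf)
open B7Prop1Explicit renaming Site → LSite
open B7Prop1Explicit (e)
open B8Eq131Cubes (cube gs)
open B10Eq27TorusAxialLog (transl transl_add_e rel)
open B11Eq115Space (levOf levOf_le mem_levOf)
open B15Eq112TorusCover (cover lift)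
open FlatCubeOpsText (IsLevWeight)
open FlatCubeSequenceAligned (cubeSeqMT3 cubeSetM inOm_cubeSeqM_iff)
open P1FlatCoreCubeInclusion (transl_zero_eq_cover cover_lift_add_rel lift_add_rel_mem_cube_zero mem_cube_of_cover_mem_cubeSetM)
open HalvingP1FlatCoreJunction (rep_shift)
open HalvingP1FlatCoreTransportAssembly (transl_mem_cubeSetM_zero_of_near cubeSetM_subset_one cubeSetM_one_subset_zero)
open Summit.QuantumFields.YangMills.Theorems (FlatMinimizerH.le_T3)

variable {F : T3Family} {n K : ℕ}

/-! ## §1 The weight level of a fine site puts it in the route cube of that level -/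

/-- **A SITE OF WEIGHT LEVEL `j ≥ 1` LIES IN `□_j^{route}`** (`levOf` of the route family `cubeSeqMT3` = membership in `cubeSetM … j`; ✓`B11Eq115Space.mem_levOf` with
`Ω₀ = everything` + ✓`inOm_cubeSeqM_iff`). [cite: Balaban1985Variational, p.286, (144) p.300; Balaban1984PropagatorsII, (2.3)-(2.4) p.224] -/
theorem mem_cubeSetM_of_levOf_eq (x₀ : Site (F.P K) 0) (ρ S M : ℕ) (hM : 1 ≤ M) (s : Site (F.P K) 0) {j : ℕ}
    (hj : levOf (fun i => {y : Site (F.P K) 0 | (cubeSeqMT3 F n K x₀ ρ S M hM).InOm i y}) (K - n) s = j) (hj1 : 1 ≤ j) :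
    s ∈ cubeSetM x₀ (K - n) ρ S M j := by
  have hk : K - n ≤ (F.P K).m + (F.P K).K := FlatMinimizerH.le_T3 F n K
  have hjk : j ≤ K - n := hj ▸ levOf_le _ _ _
  have hmem := mem_levOf (Ω := fun i => {y : Site (F.P K) 0 | (cubeSeqMT3 F n K x₀ ρ S M hM).InOm i y})
    (fun y => (cubeSeqMT3 F n K x₀ ρ S M hM).inOm_zero y) (K - n) s
  rw [hj] at hmem
  exact (inOm_cubeSeqM_iff hk hM hj1 hjk s).1 hmem

/-- **… HENCE ITS `2`-NEIGHBOURHOOD LIES IN `□₀^{route}`** (`2 ≤ S`): for a site `s` of weight level `≥ 1` and every `ℤ³` point `w` within `2` of the representative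
`rep s = lift x₀ + rel x₀ s`, the torus site `0 + w` lies in `cubeSetM x₀ (K−n) ρ S M 0`. [cite: Balaban1984PropagatorsII, (2.2) p.224; Balaban1985Variational, (144) p.300] -/
theorem transl_mem_cubeSetM_zero_of_levOf_pos (hnK : n < K) (x₀ : Site (F.P K) 0) (ρ S M : ℕ) (hM : 1 ≤ M) (hS : 2 ≤ S) (s : Site (F.P K) 0) {j : ℕ}
    (hj : levOf (fun i => {y : Site (F.P K) 0 | (cubeSeqMT3 F n K x₀ ρ S M hM).InOm i y}) (K - n) s = j) (hj1 : 1 ≤ j)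
    (w : LSite (F.P K).d) (hw : ∀ i, ((lift (F.P K) x₀ + rel x₀ s) i - w i).natAbs ≤ 2) :
    transl (0 : Site (F.P K) 0) w ∈ cubeSetM x₀ (K - n) ρ S M 0 := by
  have hk : K - n ≤ (F.P K).m + (F.P K).K := FlatMinimizerH.le_T3 F n K
  have hk1 : 1 ≤ K - n := by omega
  have hjk : j ≤ K - n := hj ▸ levOf_le _ _ _
  have hs1 : s ∈ cubeSetM x₀ (K - n) ρ S M 1 := cubeSetM_subset_one hk hM hj1 hjk (mem_cubeSetM_of_levOf_eq x₀ ρ S M hM s hj hj1)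
  have hrep : transl (0 : Site (F.P K) 0) (lift (F.P K) x₀ + rel x₀ s) = s := by
    rw [transl_zero_eq_cover]; exact cover_lift_add_rel x₀ s
  exact transl_mem_cubeSetM_zero_of_near hk hk1 hM hS (by rw [hrep]; exact hs1) hw

/-! ## §2 ★★ The two (iii) rows of the window-truncated one-form at the route's level weights -/

open Classical in
/-- ★★ **THE (1.36)♭ SIZE ROWS (iii) OF `A := X ∘ rep` (TRUNCATED TO `□₀^{route}`) AT THE ROUTE's LEVEL WEIGHTS, FROM THE (1.36) SIZES OF `X` ON N05's LEVEL CUBES** — the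
`hsize` binder of ✓`HalvingP1FlatCoreChartDataDoor.mlogChartDataMult_of_suppliers` with `B₁·ε₀ := c`.  Hypotheses: J1b's window letters; `0 ≤ c`;
(hX1) `(Lʲη)‖X z ν‖ ≤ c` on `□_j^{N05}`; (hX2) `(Lʲη)²·L^{K−n}·‖X(z+e_{ν′}) ν − X z ν‖ ≤ c` for `z ∈ □_j^{N05}` with `z + e_{ν′} ∈ □_0^{N05}`.  Conclusion: for every
`IsLevWeight F n K (cubeSeqMT3 F n K x₀ ρ S M hM) wt`, `wt 1 b·‖A b‖ ≤ c` and `wt 2 b·L^{K−n}·‖A ⟨b₋ + e_{ν′}, dir b⟩ − A b‖ ≤ c` (§1 for the levels, J1b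
✓`mem_cube_of_cover_mem_cubeSetM` for the representatives, ✓`rep_shift` for the parallel neighbour; the window-edge jump sits at level `0` only, cost `η‖X‖ ≤ c`).
[cite: Balaban1985RegularSpaces, Thm 2 p.83, (1.36)-(1.38) p.82, (1.131) p.99; Balaban1985Variational, (144) p.300, (152) p.301, p.286; Balaban1984PropagatorsII, (2.1)-(2.4) p.224] -/
theorem hsize_of_windowSizes (hnK : n < K) (x₀ : Site (F.P K) 0) (ρ S M : ℕ) (hM : 1 ≤ M) (hS : 2 ≤ S)
    {a : LSite (F.P K).d} {M' ρ' : ℕ} (h0 : ρ + M ≤ ρ' + 1) (h1 : (F.P K).L + S + M ≤ ρ' + 2)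
    (ha : ∀ ν, a ν ≤ ((iterBlockOf (K - n) x₀ ν).val : ℤ) ∧ ((iterBlockOf (K - n) x₀ ν).val : ℤ) ≤ a ν + M' - 1)
    (hroomW : 2 * ((F.P K).L ^ (K - n) * (M' + 1) + ρ' * gs (F.P K).L (K - n)) ≤ (F.P K).sitesPerDir 0)
    (X : LSite (F.P K).d → Fin (F.P K).d → Matrix (Fin 2) (Fin 2) ℂ) {c : ℝ} (hc : 0 ≤ c)
    (hX1 : ∀ j, j ≤ K - n → ∀ z ∈ cube (F.P K).L a M' ρ' (K - n) j, ∀ ν : Fin (F.P K).d,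
      (F.L : ℝ) ^ j * ((F.L : ℝ)⁻¹) ^ (K - n) * ‖X z ν‖ ≤ c)
    (hX2 : ∀ j, j ≤ K - n → ∀ z ∈ cube (F.P K).L a M' ρ' (K - n) j, ∀ ν ν' : Fin (F.P K).d,
      z + e ν' ∈ cube (F.P K).L a M' ρ' (K - n) 0 →
      ((F.L : ℝ) ^ j * ((F.L : ℝ)⁻¹) ^ (K - n)) ^ 2 * (F.L : ℝ) ^ (K - n) * ‖X (z + e ν') ν - X z ν‖ ≤ c) :
    ∀ wt : ℕ → PBond (F.P K) 0 → ℝ, IsLevWeight F n K (cubeSeqMT3 F n K x₀ ρ S M hM) wt →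
      (∀ b : PBond (F.P K) 0, wt 1 b *
        ‖(fun b : PBond (F.P K) 0 => if b.src ∈ cubeSetM x₀ (K - n) ρ S M 0 ∧ b.tgt ∈ cubeSetM x₀ (K - n) ρ S M 0 then
          X (lift (F.P K) x₀ + rel x₀ b.src) b.dir else 0) b‖ ≤ c) ∧
      (∀ (b : PBond (F.P K) 0) (ν' : Fin (F.P K).d), wt 2 b * (F.L : ℝ) ^ (K - n) *
        ‖(fun b : PBond (F.P K) 0 => if b.src ∈ cubeSetM x₀ (K - n) ρ S M 0 ∧ b.tgt ∈ cubeSetM x₀ (K - n) ρ S M 0 then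
            X (lift (F.P K) x₀ + rel x₀ b.src) b.dir else 0) ⟨b.src.shift ν', b.dir⟩ -
          (fun b : PBond (F.P K) 0 => if b.src ∈ cubeSetM x₀ (K - n) ρ S M 0 ∧ b.tgt ∈ cubeSetM x₀ (K - n) ρ S M 0 then
            X (lift (F.P K) x₀ + rel x₀ b.src) b.dir else 0) b‖ ≤ c) := by
  intro wt hwt
  have hk : K - n ≤ (F.P K).m + (F.P K).K := FlatMinimizerH.le_T3 F n K
  have hL1 : (1 : ℝ) ≤ F.L := by exact_mod_cast (F.P K).L_pos
  have hL0 : (0 : ℝ) < F.L := by linarith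
  -- letters: the window, the representative, the weight level
  set Ω₀ : Set (Site (F.P K) 0) := cubeSetM x₀ (K - n) ρ S M 0 with hΩ₀
  set rep : Site (F.P K) 0 → LSite (F.P K).d := fun s => lift (F.P K) x₀ + rel x₀ s with hrepdef
  set lev : Site (F.P K) 0 → ℕ := fun s => levOf (fun i => {y : Site (F.P K) 0 | (cubeSeqMT3 F n K x₀ ρ S M hM).InOm i y}) (K - n) s with hlev
  have hw1 : ∀ b : PBond (F.P K) 0, wt 1 b = (F.L : ℝ) ^ lev b.src * ((F.L : ℝ)⁻¹) ^ (K - n) := fun b => by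
    rw [hwt 1 b, pow_one]
  have hw2 : ∀ b : PBond (F.P K) 0, wt 2 b = ((F.L : ℝ) ^ lev b.src * ((F.L : ℝ)⁻¹) ^ (K - n)) ^ 2 := fun b => by
    rw [hwt 2 b]
  have hlevk : ∀ s, lev s ≤ K - n := fun s => levOf_le _ _ _
  -- the representative of a window site lies in N05's cube of its weight level
  have hrep0 : ∀ s ∈ Ω₀, rep s ∈ cube (F.P K).L a M' ρ' (K - n) 0 := fun s hs => lift_add_rel_mem_cube_zero hk hM h0 h1 ha hs
  have hrepj : ∀ s ∈ Ω₀, rep s ∈ cube (F.P K).L a M' ρ' (K - n) (lev s) := by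
    intro s hs
    rcases Nat.eq_zero_or_pos (lev s) with h0' | hpos
    · rw [h0']; exact hrep0 s hs
    · exact mem_cube_of_cover_mem_cubeSetM hk hM h0 h1 ha hroomW (hlevk s) (hrep0 s hs)
        (by rw [cover_lift_add_rel]; exact mem_cubeSetM_of_levOf_eq x₀ ρ S M hM s rfl hpos)
  -- at weight level `≥ 1` every bond from `s` and from `s + e_{ν′}` has both ends in the window
  have hwin_of_pos : ∀ (s : Site (F.P K) 0), 1 ≤ lev s → ∀ ν' μ : Fin (F.P K).d,
      (s ∈ Ω₀ ∧ s.shift μ ∈ Ω₀) ∧ ((s.shift ν') ∈ Ω₀ ∧ (s.shift ν').shift μ ∈ Ω₀) := by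
    intro s hpos ν' μ
    have hrs : transl (0 : Site (F.P K) 0) (rep s) = s := by
      rw [transl_zero_eq_cover]; exact cover_lift_add_rel x₀ s
    have near : ∀ w : LSite (F.P K).d, (∀ i, (rep s i - w i).natAbs ≤ 2) → transl (0 : Site (F.P K) 0) w ∈ Ω₀ := fun w hw =>
      transl_mem_cubeSetM_zero_of_levOf_pos hnK x₀ ρ S M hM hS s rfl hpos w hw
    have e1 : ∀ (κ : Fin (F.P K).d) (i : Fin (F.P K).d), ((e κ : LSite (F.P K).d) i).natAbs ≤ 1 := fun κ i => by
      rw [B7Prop1Explicit.e_apply]; split_ifs <;> simp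
    refine ⟨⟨?_, ?_⟩, ?_, ?_⟩
    · simpa only [hrs] using near (rep s) (fun i => by simp)
    · have h := near (rep s + e μ) (fun i => by
        have := e1 μ i; simp only [Pi.add_apply, sub_add_cancel_left, Int.natAbs_neg]; omega)
      rwa [transl_add_e, hrs] at h
    · have h := near (rep s + e ν') (fun i => by
        have := e1 ν' i; simp only [Pi.add_apply, sub_add_cancel_left, Int.natAbs_neg]; omega)
      rwa [transl_add_e, hrs] at h
    · have h := near (rep s + e ν' + e μ) (fun i => by
        have h1 := e1 ν' i; have h2 := e1 μ i
        simp only [Pi.add_apply]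
        have : rep s i - (rep s i + (e ν' : LSite (F.P K).d) i + (e μ : LSite (F.P K).d) i) =
            -((e ν' : LSite (F.P K).d) i + (e μ : LSite (F.P K).d) i) := by ring
        rw [this, Int.natAbs_neg]
        exact (Int.natAbs_add_le _ _).trans (by omega))
      rwa [transl_add_e, transl_add_e, hrs] at h
  -- `η²·L^{K−n} = η`
  have hηL : (((F.L : ℝ)⁻¹) ^ (K - n)) ^ 2 * (F.L : ℝ) ^ (K - n) = ((F.L : ℝ)⁻¹) ^ (K - n) := by
    rw [inv_pow, sq, mul_assoc, inv_mul_cancel₀ (pow_ne_zero _ hL0.ne'), mul_one]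
  refine ⟨fun b => ?_, fun b ν' => ?_⟩
  · -- row 1
    dsimp only
    by_cases hb : b.src ∈ Ω₀ ∧ b.tgt ∈ Ω₀
    · rw [if_pos hb, hw1 b]
      exact hX1 (lev b.src) (hlevk b.src) (rep b.src) (hrepj b.src hb.1) b.dir
    · rw [if_neg hb, norm_zero, mul_zero]; exact hc
  · -- row 2: four window cases
    dsimp only
    by_cases hb : b.src ∈ Ω₀ ∧ b.tgt ∈ Ω₀
    · by_cases hb' : b.src.shift ν' ∈ Ω₀ ∧ (b.src.shift ν').shift b.dir ∈ Ω₀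
      · -- both inside: the parallel neighbour's representative is `rep b₋ + e_{ν′}`
        rw [if_pos hb, if_pos (show (⟨b.src.shift ν', b.dir⟩ : PBond (F.P K) 0).src ∈ Ω₀ ∧
          (⟨b.src.shift ν', b.dir⟩ : PBond (F.P K) 0).tgt ∈ Ω₀ from hb'), hw2 b]
        have hsh : lift (F.P K) x₀ + rel x₀ (b.src.shift ν') = (lift (F.P K) x₀ + rel x₀ b.src) + e ν' :=
          rep_shift hk hM h0 h1 ha hroomW hb.1 ν' hb'.1
        have hz' : (lift (F.P K) x₀ + rel x₀ b.src) + e ν' ∈ cube (F.P K).L a M' ρ' (K - n) 0 := by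
          rw [← hsh]; exact hrep0 _ hb'.1
        rw [hsh]
        exact hX2 (lev b.src) (hlevk b.src) (rep b.src) (hrepj b.src hb.1) b.dir ν' hz'
      · -- inside∕outside: level `0`, the surviving value is `X (rep b₋)`
        rw [if_pos hb, if_neg (show ¬ ((⟨b.src.shift ν', b.dir⟩ : PBond (F.P K) 0).src ∈ Ω₀ ∧
          (⟨b.src.shift ν', b.dir⟩ : PBond (F.P K) 0).tgt ∈ Ω₀) from hb'), zero_sub, norm_neg, hw2 b]
        have hlev0 : lev b.src = 0 := by
          by_contra hne
          exact hb' (hwin_of_pos b.src (Nat.one_le_iff_ne_zero.mpr hne) ν' b.dir).2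
        rw [hlev0, pow_zero, one_mul, hηL]
        have h := hX1 0 (Nat.zero_le _) (rep b.src) (hrep0 b.src hb.1) b.dir
        rwa [pow_zero, one_mul] at h
    · by_cases hb' : b.src.shift ν' ∈ Ω₀ ∧ (b.src.shift ν').shift b.dir ∈ Ω₀
      · -- outside∕inside: level `0`, the surviving value is `X (rep (b₋ + e_{ν′}))`
        rw [if_neg hb, if_pos (show (⟨b.src.shift ν', b.dir⟩ : PBond (F.P K) 0).src ∈ Ω₀ ∧
          (⟨b.src.shift ν', b.dir⟩ : PBond (F.P K) 0).tgt ∈ Ω₀ from hb'), sub_zero, hw2 b]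
        have hlev0 : lev b.src = 0 := by
          by_contra hne
          exact hb (hwin_of_pos b.src (Nat.one_le_iff_ne_zero.mpr hne) ν' b.dir).1
        rw [hlev0, pow_zero, one_mul, hηL]
        have h := hX1 0 (Nat.zero_le _) (rep (b.src.shift ν')) (hrep0 _ hb'.1) b.dir
        rwa [pow_zero, one_mul] at h
      · rw [if_neg hb, if_neg (show ¬ ((⟨b.src.shift ν', b.dir⟩ : PBond (F.P K) 0).src ∈ Ω₀ ∧
          (⟨b.src.shift ν', b.dir⟩ : PBond (F.P K) 0).tgt ∈ Ω₀) from hb'), sub_zero, norm_zero, mul_zero]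
        exact hc

end Summit.QuantumFields.YangMills.Theorems.HalvingP1FlatCoreWindowSizes

end
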